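/-
Copyright (c) 2026 the pub-hodgecm-mathlib formalisation cell (harness21).  Prover seat hodgecm-mathlib-LH4-p08 (g12), req620 Track A «(D-RAM) FOUR-FRAME» squad
(STAGE-1b, row (2) of the piece `f_{T₊}`, the (β₂) road (R-36), the K6 road; K6 desk LH4-p16 (g3) WORD #27 «p08: A5-SIZES — the one remaining plumbing piece between
★ `topCell_density` and A6»), 2026-09-05.
-/
import Summits.HodgeConjecture.HodgeConjecture.Theorems.F0P3cDyRamTopCellDensity            -- ★ p864904 (this seat): `topCell_density_exists` (the top cell's density from SIZE letters)
import Summits.HodgeConjecture.HodgeConjecture.Theorems.F0P3cDyRamBeta2ConesRowSizesAllD     -- ★ p864432 (LH7-p06 (g3)): even-row n-table `rowSize_near ∕ _boundary_* ∕ _far_*`; brings ★ `rowSize_diag`, `two_le_d`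
import Summits.HodgeConjecture.HodgeConjecture.Theorems.F0P3cDyRamBeta2ConesRowSizesAllDOdd  -- ★ p864803 (LH7-p06 (g3)): odd-row n-table `rowSize_diag_odd`, `rowSize_*_odd`
import HarnessLib

/-!
# Crux `H413`, line LH4 «(D-RAM) FOUR-FRAME» — STAGE-1b, row (2), the (β₂) road (R-36), K6 node A5-SIZES: «THE TOP CELL'S DENSITY FROM THE ROW» — the density letters
# `hdensH`, `hdensA` of ★ A5 `topCell_identity` (p865015), discharged from the ★ size tables, BOTH parities, `N = 0` allowed

Cell `hodgecm-mathlib` (D-0151), FLOOR 0, crux item H413 = `stmt-HodgeConjecture-24833`, route of record `HCCMUnconditional`; squad F0∕P3c∕LH4; lane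
`--supports stmt-HodgeConjecture-24833 --as helper` (count-neutral; pays NO tier-0 row).  THEOREMS ONLY (no `def`, no instance, no notation, no `sorry`, default heartbeats);
★-only imports; states NO law; GENERIC (no CM token).

WHAT (K6 desk LH4-p16 (g3) WORD #27).  ★ A5 `topCell_identity` takes the top DENSITY letters hypothesis-first: `hdensH : n_H(b+2N) = φd·#(Rd.filter LIT_H)`,
`hdensA : N < d → n_A(b+2N) = φd·#(Rd.filter LIT_A)` (`LIT_t` = ★ F1b-top's literal lambda at `j := b + 2N`, TOP chart `|ξ₀| = exp 2N`); ★ `topCell_density_exists` (p864904) gives them from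
four SIZE letters at the top index; the sizes are ★ `rowSize_diag` + ★ p864432 `rowSize_near ∕ rowSize_boundary_hyp_allD ∕ rowSize_boundary_aniso_allD ∕ rowSize_far_hyp_allD` (even row
`2b = m`) and ★ p864803 `rowSize_diag_odd ∕ rowSize_*_odd` (odd row `2b + 1 = m`).  THIS FILE is that plumbing, ONCE, for both frames of ‹CORE.v1›∕‹CORE-ODD.v1› in ★ `topCell_identity`'s
letters (the hyperbolic literal `((Φ₂).over E, 1; γ₂, φ, h, f)` with its isotropic vector `hhyper`, the anisotropic literal `(diag dg, η; P₁, γA, φ′, h′, f′)` with `haniso`; frame facts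
★ `StdForm.over_map`+`transpose_over`, `Matrix.diagonal_map`+`diagonal_transpose` as ★ A3 p864851 ∕ ★ `row_of_core`):
* `exists_topCell_density_of_row` (even row `2b = m`) and `exists_topCell_density_of_row_odd` (odd row `2b + 1 = m`): window `m + 2N = jl` with **`N = 0` ALLOWED** (the δ = 0 corner:
  then only ★ `rowSize_diag(_odd)` is used), TOP chart `κ₀ + ρκ₀ = 1`, `|κ₀| = 1`, `ρξ₀ = −ξ₀`, `|ξ₀| = exp 2N`, a top digit system `Rd` modulo `|ϖ|^n` with `2d − 1 ≤ n ≤ b` ⟹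
  **`∃ φd : ℤ, ‹hdensH› ∧ (N < d → ‹hdensA›)`** in ★ `topCell_identity`'s bytes (`φd = 2·q^{2b+N−(n+1)∕2}` inside).
Consumers: the K6 desk's A6 `core_holds` ∕ `coreOdd_holds` (`obtain ⟨φd, hdensH, hdensA⟩ := …; exact topCell_identity … hdensH hdensA`) and the δ = 0 composer (γ).
WHAT IS NOT CLAIMED: the top laws, `htop`, any census identity; ‹CORE›∕‹CORE-ODD› and (β₂) stay HYPOTHESES of their consumers.
HONEST LABEL.  Count-neutral plumbing over ★ tables; nothing printed is asserted; `HC_CM` is proved only modulo the 7 printed citations (2 remaining named inputs: hLiu418 =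
`stmt-HodgeConjecture-24832`, h413 = `stmt-HodgeConjecture-24833`) until rung 0 closes.
## References
* [Kottwitz1986BaseChangeUnits] R. E. Kottwitz, *Base change for unit elements of Hecke algebras*, Compositio Math. 60 (1986): §1 pp. 240–241 (cell-by-cell fixed-lattice counts).
* [Flicker1998UnitaryFL] Y. Z. Flicker, *Elementary proof of the fundamental lemma for a unitary group*, Canad. J. Math. 50 (1998): Prop. 7 p. 84 (the level tables by classes).
* [Serre1979] J.-P. Serre, *Local Fields*, GTM 67 (1979): Ch. V §3 Prop. 5, Cor. 2–3 pp. 84–86 (norm index two, residue counts).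
* [Rogawski1990] J. D. Rogawski, *Automorphic Representations of Unitary Groups in Three Variables*, Ann. of Math. Stud. 123 (1990): §4.9 Prop. 4.9.1 (b) p. 55.
-/

set_option autoImplicit false

noncomputable section

namespace Summit.HodgeConjecture.HodgeConjecture.Cruxes.H413.F0P3cDyRamTopCellDensityOfRow

open scoped Valued WithZero Matrix MatrixGroups Classical
open WithZero Finset
open Literature.NumberTheory.Automorphic Literature.NumberTheory.Automorphic.HermitianLattice Literature.NumberTheory.Automorphic.UnitaryLatticeTree
open Literature.NumberTheory.Automorphic.UnitaryThreeFourFrame (IsRamifiedQuadraticDatum)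
open Literature.NumberTheory.Rogawski1990
open Summit.HodgeConjecture.HodgeConjecture.Cruxes.H413.F0P3cDyRamFourFramePieces
open Summit.HodgeConjecture.HodgeConjecture.Cruxes.H413.F0P3cDyRamToricCensusDefs
open Summit.HodgeConjecture.HodgeConjecture.Cruxes.H413.F0P3cDyRamBeta2ConesRowSizes (two_le_d rowSize_diag)
open Summit.HodgeConjecture.HodgeConjecture.Cruxes.H413.F0P3cDyRamBeta2ConesRowSizesAllD (rowSize_near rowSize_boundary_hyp_allD rowSize_boundary_aniso_allD rowSize_far_hyp_allD)
open Summit.HodgeConjecture.HodgeConjecture.Cruxes.H413.F0P3cDyRamBeta2ConesRowSizesAllDOdd (rowSize_diag_odd rowSize_near_odd rowSize_boundary_hyp_odd rowSize_boundary_aniso_odd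
  rowSize_far_hyp_odd)
open Summit.HodgeConjecture.HodgeConjecture.Cruxes.H413.F0P3cDyRamTopCellDensity (topCell_density_exists)

variable {E M : Type} [Field E] [Valued E ℤᵐ⁰] [Field M] [Valued M ℤᵐ⁰]

/-! ## §1 The even row `2b = m` -/

/-- **A5-SIZES, EVEN ROW — «THE TOP CELL'S DENSITY FROM THE ROW»** (K6 desk WORD #27).  ★ `topCell_identity`'s two-frame letters BY NAME (the subset the size tables need, plus the
hyperbolic literal's isotropic vector `hhyper` and the anisotropic literal's `haniso` — ‹CORE.v1›'s `_hhyper` and its anisotropy premise), the row `1 ≤ b`, `2b = m`, the window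
`m + 2N = jl` (`N = 0` allowed), the TOP chart and a top digit system `Rd` modulo `|ϖ|^n` with `2d − 1 ≤ n ≤ b` ⟹ `∃ φd, n_H(b+2N) = φd·#(Rd.filter LIT_H) ∧ (N < d → n_A(b+2N) = φd·#(Rd.filter LIT_A))`
in ★ `topCell_identity`'s `hdensH`∕`hdensA` bytes — ★ `topCell_density_exists` with its size letters paid by ★ `rowSize_diag` and ★ p864432 at `i := N`.
[cite: Kottwitz1986BaseChangeUnits, §1 pp. 240–241] [cite: Flicker1998UnitaryFL, Prop. 7 p. 84] [cite: Serre1979, Ch. V §3 Prop. 5, Cor. 2–3 pp. 84–86] [cite: Rogawski1990, §4.9 Prop. 4.9.1 (b) p. 55] -/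
theorem exists_topCell_density_of_row [CompleteSpace E] [IsDiscreteValuationRing 𝒪[E]] [Finite 𝓀[E]] [CompleteSpace M] [IsDiscreteValuationRing 𝒪[M]] [Finite 𝓀[M]]
    (σ : E →+* E) (ϖ : E) (d tE : ℕ) (hD : IsRamifiedQuadraticDatum σ ϖ d tE) (hσσ : ∀ a, σ (σ a) = a) (h2 : ¬ IsUnit (2 : 𝒪[E]))
    (jE : E →+* M) (ρ Θ : M →+* M) (α lam : M)
    (hρρ : ∀ z, ρ (ρ z) = z) (hvρ : ∀ z, Valued.v (ρ z) = Valued.v z)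
    (hjv : ∀ a, Valued.v (jE a) ≤ 1 ↔ Valued.v a ≤ 1) (hjfix : ∀ z : M, ρ z = z ↔ ∃ a, jE a = z) (hΘj : ∀ a, Θ (jE a) = jE (σ a))
    (hΘΘ : ∀ z, Θ (Θ z) = z) (hΘρ : ∀ z, Θ (ρ z) = ρ (Θ z)) (hvΘ : ∀ z, Valued.v (Θ z) = Valued.v z)
    (hα : ρ α ≠ α) (hα1 : Valued.v α ≤ 1) (hint : ∀ z : M, Valued.v z ≤ 1 → Valued.v ((z - ρ z) / (α - ρ α)) ≤ 1)
    (hvlam : Valued.v lam = 1) (hU : Valued.v (α - ρ α) = 1) (hτ : Valued.v (α - Θ α) < 1)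
    (hσres : ∀ z : M, ρ z = z → Valued.v z ≤ 1 → Valued.v (Θ z - z) < 1)
    (hDM : IsRamifiedQuadraticDatum Θ (jE ϖ) d tE) (hjiso : ∀ a, Valued.v (jE a) = Valued.v a)
    (hq : Nat.card 𝓀[M] = Nat.card 𝓀[E] ^ 2) (hjpow : ∀ (t : E) (n : ℤ), Valued.v (jE t) = Valued.v (jE ϖ) ^ n ↔ Valued.v t = Valued.v ϖ ^ n)
    (hϖmax : ∀ t : M, ρ t = t → Valued.v t < 1 → Valued.v t ≤ Valued.v (jE ϖ))
    (u : GL (Fin 1) E) (m jl : ℕ) (hm : Valued.v (lam - jE ((u : Matrix (Fin 1) (Fin 1) E) 0 0)) = WithZero.exp (-(m : ℤ)))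
    (hjl : Valued.v ((lam - jE ((u : Matrix (Fin 1) (Fin 1) E) 0 0)) - ρ (lam - jE ((u : Matrix (Fin 1) (Fin 1) E) 0 0))) = WithZero.exp (-(jl : ℤ)))
    -- the HYPERBOLIC literal `((Φ₂).over E, 1; γ₂, φ, h, f)` with its isotropic vector (‹CORE.v1›'s `_hhyper`)
    (γ₂ : GL (Fin 2) E) (φ : (Fin 2 → E) →+ M) (h : M) (hφs : ∀ (c : E) (x : Fin 2 → E), φ (c • x) = jE c * φ x) (hφi : Function.Injective φ) (hφo : Function.Surjective φ)
    (hφγ : ∀ x, φ ((γ₂ : Matrix (Fin 2) (Fin 2) E).mulVec x) = lam * φ x)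
    (hform : ∀ x y, jE (pairing σ ((StdForm.antidiagonal 2).over E) x y) = h * Θ (φ x) * φ y + ρ (h * Θ (φ x) * φ y)) (hΘh : Θ h = h) (hh : h ≠ 0)
    (hhyper : ∃ x : M, x ≠ 0 ∧ h * Θ x * x + ρ (h * Θ x * x) = 0)
    (f : ℕ → ℕ → AddSubgroup M → ℕ) (hfinLS : ∀ j a, (levelSet ρ Θ α (jE ϖ) h j a).Finite)
    (hf : ∀ (b j : ℕ) (Λ : AddSubgroup M) (x₀ : M) (r : E), 1 ≤ b → x₀ ≠ 0 → (∀ x, x ∈ Λ ↔ ∃ z, IsOrd ρ α (jE ϖ ^ j) z ∧ x = x₀ * z) →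
      IsOrd ρ α (jE ϖ ^ j) (dualGen ρ Θ α (jE ϖ ^ j) h x₀) → ¬ IsOrd ρ α (jE ϖ ^ j) (dualGen ρ Θ α (jE ϖ ^ j) h x₀ / jE ϖ) → Valued.v (dualGen ρ Θ α (jE ϖ ^ j) h x₀) = Valued.v (jE ϖ) ^ b →
      (∀ b', (∀ x ∈ Λ, Valued.v (h * Θ x * b' + ρ (h * Θ x * b')) ≤ 1) → (lam - jE ((u : Matrix (Fin 1) (Fin 1) E) 0 0)) * b' ∈ Λ) → IsOrd ρ α (jE ϖ ^ j) lam →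
      jE r = glueUnit ρ Θ α (jE ϖ ^ j) h (jE ϖ) (jE (1 : E)) x₀ b →
      f b j Λ = Nat.card {x : 𝒪[E] ⧸ 𝓂[E] ^ (2 * b) // ∃ u' : 𝒪[E], Ideal.Quotient.mk (𝓂[E] ^ (2 * b)) u' = x ∧ Valued.v ((u' : E) * σ u' - r) ≤ Valued.v (ϖ ^ (2 * b))})
    -- the ANISOTROPIC literal `(diag dg, η; P₁, γA, φ′, h′, f′)` with its anisotropy (‹CORE.v1›'s premise)
    (P₁ : GL (Fin 3) E) (dg : Fin 2 → E) (η : E) (γA : GL (Fin 2) E)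
    (hA : formCongr σ P₁ ((StdForm.antidiagonal 3).over E) =
      (!![(Matrix.diagonal dg) 0 0, 0, (Matrix.diagonal dg) 0 1; 0, η, 0; (Matrix.diagonal dg) 1 0, 0, (Matrix.diagonal dg) 1 1] : Matrix (Fin 3) (Fin 3) E))
    (hdgσ : ∀ i, σ (dg i) = dg i) (hησ : σ η = η) (hη1 : Valued.v η = 1) (hηN : ¬ ∃ t : E, t * σ t = η)
    (φ' : (Fin 2 → E) →+ M) (h' : M) (hφ's : ∀ (c : E) (x : Fin 2 → E), φ' (c • x) = jE c * φ' x) (hφ'i : Function.Injective φ') (hφ'o : Function.Surjective φ')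
    (hφ'γ : ∀ x, φ' ((γA : Matrix (Fin 2) (Fin 2) E).mulVec x) = lam * φ' x)
    (hform' : ∀ x y, jE (pairing σ (Matrix.diagonal dg) x y) = h' * Θ (φ' x) * φ' y + ρ (h' * Θ (φ' x) * φ' y)) (hΘh' : Θ h' = h') (hh' : h' ≠ 0)
    (haniso : ¬ ∃ x : M, x ≠ 0 ∧ h' * Θ x * x + ρ (h' * Θ x * x) = 0)
    (f' : ℕ → ℕ → AddSubgroup M → ℕ) (hfinLS' : ∀ j a, (levelSet ρ Θ α (jE ϖ) h' j a).Finite)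
    (hf' : ∀ (b j : ℕ) (Λ : AddSubgroup M) (x₀ : M) (r : E), 1 ≤ b → x₀ ≠ 0 → (∀ x, x ∈ Λ ↔ ∃ z, IsOrd ρ α (jE ϖ ^ j) z ∧ x = x₀ * z) →
      IsOrd ρ α (jE ϖ ^ j) (dualGen ρ Θ α (jE ϖ ^ j) h' x₀) → ¬ IsOrd ρ α (jE ϖ ^ j) (dualGen ρ Θ α (jE ϖ ^ j) h' x₀ / jE ϖ) → Valued.v (dualGen ρ Θ α (jE ϖ ^ j) h' x₀) = Valued.v (jE ϖ) ^ b →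
      (∀ b', (∀ x ∈ Λ, Valued.v (h' * Θ x * b' + ρ (h' * Θ x * b')) ≤ 1) → (lam - jE ((u : Matrix (Fin 1) (Fin 1) E) 0 0)) * b' ∈ Λ) → IsOrd ρ α (jE ϖ ^ j) lam →
      jE r = glueUnit ρ Θ α (jE ϖ ^ j) h' (jE ϖ) (jE η) x₀ b →
      f' b j Λ = Nat.card {x : 𝒪[E] ⧸ 𝓂[E] ^ (2 * b) // ∃ u' : 𝒪[E], Ideal.Quotient.mk (𝓂[E] ^ (2 * b)) u' = x ∧ Valued.v ((u' : E) * σ u' - r) ≤ Valued.v (ϖ ^ (2 * b))})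
    -- the live row and its window (`N = 0` allowed)
    (b : ℕ) (hb1 : 1 ≤ b) (hb2 : 2 * b = m) {N : ℕ} (hNjl : m + 2 * N = jl)
    -- the TOP chart
    {κ₀ ξ₀ : M} (hκ₀ : κ₀ + ρ κ₀ = 1) (hΘκ₀ : Θ κ₀ = κ₀) (hκ₀v : Valued.v κ₀ = 1) (hξ : ρ ξ₀ = -ξ₀) (hΘξ : Θ ξ₀ = ξ₀)
    (hξN : Valued.v ξ₀ = exp (2 * (N : ℤ)))
    -- the top digit system, `2d − 1 ≤ n ≤ b`
    (Rd : Finset E) {n : ℕ} (hn : 2 * d - 1 ≤ n) (hnb : n ≤ b) (hRd1 : ∀ V ∈ Rd, σ V = V ∧ Valued.v V ≤ 1)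
    (hRd2 : ∀ V : E, σ V = V → Valued.v V ≤ 1 → ∃ V₀ ∈ Rd, Valued.v (V - V₀) ≤ Valued.v ϖ ^ n)
    (hRd3 : ∀ V ∈ Rd, ∀ V' ∈ Rd, Valued.v (V - V') ≤ Valued.v ϖ ^ n → V = V') :
    ∃ φd : ℤ,
      ((∑ᶠ Λ ∈ levelSetDep ρ Θ α (jE ϖ) h (b + 2 * N) b (lam - jE ((u : Matrix (Fin 1) (Fin 1) E) 0 0)), f b (b + 2 * N) Λ : ℕ) : ℤ) =
        φd * ((Rd.filter (fun V₀ : E => Valued.v (κ₀ + jE V₀ * ξ₀) * Valued.v (jE ϖ ^ (b + 2 * N) * (α - ρ α)) = Valued.v (jE ϖ) ^ b ∧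
          ∃ e : M, ρ e = e ∧ e * Θ e = (κ₀ + jE V₀ * ξ₀) * ρ (κ₀ + jE V₀ * ξ₀) / (h * ρ h))).card : ℤ) ∧
      (N < d → ((∑ᶠ Λ ∈ levelSetDep ρ Θ α (jE ϖ) h' (b + 2 * N) b (lam - jE ((u : Matrix (Fin 1) (Fin 1) E) 0 0)), f' b (b + 2 * N) Λ : ℕ) : ℤ) =
        φd * ((Rd.filter (fun V₀ : E => Valued.v (κ₀ + jE V₀ * ξ₀) * Valued.v (jE ϖ ^ (b + 2 * N) * (α - ρ α)) = Valued.v (jE ϖ) ^ b ∧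
          ∃ e : M, ρ e = e ∧ e * Θ e = (κ₀ + jE V₀ * ξ₀) * ρ (κ₀ + jE V₀ * ξ₀) / (h' * ρ h'))).card : ℤ)) := by
  obtain ⟨h2v, -⟩ := two_le_d hD h2
  have hρj : ∀ a, ρ (jE a) = jE a := fun a => (hjfix (jE a)).2 ⟨a, rfl⟩
  -- the two literals' hermitian letters (as in ★ `row_of_core` ∕ ★ A3)
  have hH₂σ : ((((StdForm.antidiagonal 2).over E).map σ))ᵀ = (StdForm.antidiagonal 2).over E := by rw [StdForm.over_map, StdForm.transpose_over]
  have hH₂σ' : ((Matrix.diagonal dg).map σ)ᵀ = Matrix.diagonal dg := by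
    rw [Matrix.diagonal_map (map_zero _), Matrix.diagonal_transpose]; exact congrArg Matrix.diagonal (funext hdgσ)
  have h1v : Valued.v (1 : E) = 1 := Valuation.map_one _
  have h1σ : σ 1 = 1 := map_one σ
  have hqq : (Nat.card 𝓀[E] : ℤ) ^ b * (Nat.card 𝓀[E] : ℤ) ^ b = (Nat.card 𝓀[E] : ℤ) ^ (2 * b) := by rw [← pow_add, ← two_mul]
  have hjli : 2 * b + 2 * N ≤ jl := by omega
  -- the diagonal sizes `n_t(b, b) = q^b·q^b`
  have hnD := rowSize_diag hD hσσ h2 hρρ hvρ hρj hjv hjfix hΘj hΘΘ hΘρ hvΘ hα hα1 hint hvlam hU hτ hσres hDM hjiso hq hjpow hϖmax hm hjl hH₂σ h1v h1σ hφs hφi hφo hφγ hform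
    hΘh hh hfinLS hf b hb2 hb1
  have hnD' := rowSize_diag hD hσσ h2 hρρ hvρ hρj hjv hjfix hΘj hΘΘ hΘρ hvΘ hα hα1 hint hvlam hU hτ hσres hDM hjiso hq hjpow hϖmax hm hjl hH₂σ' hη1 hησ hφ's hφ'i hφ'o hφ'γ
    hform' hΘh' hh' hfinLS' hf' b hb2 hb1
  refine topCell_density_exists hD h2v jE hjfix hΘj hjiso hρρ hvρ hΘρ P₁ dg η hA hηN φ hform hΘh hh φ' hform' hΘh' hh' hκ₀ hΘκ₀ hκ₀v hξ hΘξ hξN hU rfl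
    Rd hRd1 hRd2 hRd3 hn (by omega) _ _ ?_ ?_ ?_ ?_
  · intro hN0; subst hN0
    simp only [Nat.mul_zero, Nat.add_zero]
    exact ⟨hnD.trans hqq, hnD'.trans hqq⟩
  · intro hN1 hlt
    exact ⟨by rw [rowSize_near hD hσσ h2 hρρ hvρ hρj hjv hjfix hΘj hΘΘ hΘρ hvΘ hα hα1 hint hvlam hU hτ hσres hDM hjiso hq hjpow hϖmax hm hjl hH₂σ h1v h1σ hφs hφi hφo hφγ
        hform hΘh hh hfinLS hf b hb2 hb1 N hN1 hlt hjli, hnD, hqq],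
      by rw [rowSize_near hD hσσ h2 hρρ hvρ hρj hjv hjfix hΘj hΘΘ hΘρ hvΘ hα hα1 hint hvlam hU hτ hσres hDM hjiso hq hjpow hϖmax hm hjl hH₂σ' hη1 hησ hφ's hφ'i hφ'o
        hφ'γ hform' hΘh' hh' hfinLS' hf' b hb2 hb1 N hN1 hlt hjli, hnD', hqq]⟩
  · intro hN1 heq
    exact ⟨by rw [rowSize_boundary_hyp_allD hD hσσ h2 hρρ hvρ hρj hjv hjfix hΘj hΘΘ hΘρ hvΘ hα hα1 hint hvlam hU hτ hσres hDM hjiso hq hjpow hϖmax hm hjl hH₂σ h1v h1σ hφs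
        hφi hφo hφγ hform hΘh hh hfinLS hf b hb2 hb1 hhyper N heq hjli, hnD, hqq],
      by rw [rowSize_boundary_aniso_allD hD hσσ h2 hρρ hvρ hρj hjv hjfix hΘj hΘΘ hΘρ hvΘ hα hα1 hint hvlam hU hτ hσres hDM hjiso hq hjpow hϖmax hm hjl hH₂σ' hη1 hησ
        hφ's hφ'i hφ'o hφ'γ hform' hΘh' hh' hfinLS' hf' b hb2 hb1 haniso N heq hjli, hnD', hqq]⟩
  · intro hN1 hdi
    rw [rowSize_far_hyp_allD hD hσσ h2 hρρ hvρ hρj hjv hjfix hΘj hΘΘ hΘρ hvΘ hα hα1 hint hvlam hU hτ hσres hDM hjiso hq hjpow hϖmax hm hjl hH₂σ h1v h1σ hφs hφi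
        hφo hφγ hform hΘh hh hfinLS hf b hb2 hb1 hhyper N hdi hjli, hnD, hqq]

/-! ## §2 The odd row `2b + 1 = m` -/

/-- **A5-SIZES, ODD ROW — «THE TOP CELL'S DENSITY FROM THE ROW»** (K6 desk WORD #27): the twin of `exists_topCell_density_of_row` at `2b + 1 = m` (‹CORE-ODD.v1›'s row), the
sizes paid by ★ p864803 `rowSize_diag_odd ∕ rowSize_near_odd ∕ rowSize_boundary_hyp_odd ∕ rowSize_boundary_aniso_odd ∕ rowSize_far_hyp_odd` at `i := N`; same conclusion bytes.
[cite: Kottwitz1986BaseChangeUnits, §1 pp. 240–241] [cite: Flicker1998UnitaryFL, Prop. 7 p. 84] [cite: Serre1979, Ch. V §3 Prop. 5, Cor. 2–3 pp. 84–86] [cite: Rogawski1990, §4.9 Prop. 4.9.1 (b) p. 55] -/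
theorem exists_topCell_density_of_row_odd [CompleteSpace E] [IsDiscreteValuationRing 𝒪[E]] [Finite 𝓀[E]] [CompleteSpace M] [IsDiscreteValuationRing 𝒪[M]] [Finite 𝓀[M]]
    (σ : E →+* E) (ϖ : E) (d tE : ℕ) (hD : IsRamifiedQuadraticDatum σ ϖ d tE) (hσσ : ∀ a, σ (σ a) = a) (h2 : ¬ IsUnit (2 : 𝒪[E]))
    (jE : E →+* M) (ρ Θ : M →+* M) (α lam : M)
    (hρρ : ∀ z, ρ (ρ z) = z) (hvρ : ∀ z, Valued.v (ρ z) = Valued.v z)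
    (hjv : ∀ a, Valued.v (jE a) ≤ 1 ↔ Valued.v a ≤ 1) (hjfix : ∀ z : M, ρ z = z ↔ ∃ a, jE a = z) (hΘj : ∀ a, Θ (jE a) = jE (σ a))
    (hΘΘ : ∀ z, Θ (Θ z) = z) (hΘρ : ∀ z, Θ (ρ z) = ρ (Θ z)) (hvΘ : ∀ z, Valued.v (Θ z) = Valued.v z)
    (hα : ρ α ≠ α) (hα1 : Valued.v α ≤ 1) (hint : ∀ z : M, Valued.v z ≤ 1 → Valued.v ((z - ρ z) / (α - ρ α)) ≤ 1)
    (hvlam : Valued.v lam = 1) (hU : Valued.v (α - ρ α) = 1) (hτ : Valued.v (α - Θ α) < 1)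
    (hσres : ∀ z : M, ρ z = z → Valued.v z ≤ 1 → Valued.v (Θ z - z) < 1)
    (hDM : IsRamifiedQuadraticDatum Θ (jE ϖ) d tE) (hjiso : ∀ a, Valued.v (jE a) = Valued.v a)
    (hq : Nat.card 𝓀[M] = Nat.card 𝓀[E] ^ 2) (hjpow : ∀ (t : E) (n : ℤ), Valued.v (jE t) = Valued.v (jE ϖ) ^ n ↔ Valued.v t = Valued.v ϖ ^ n)
    (hϖmax : ∀ t : M, ρ t = t → Valued.v t < 1 → Valued.v t ≤ Valued.v (jE ϖ))
    (u : GL (Fin 1) E) (m jl : ℕ) (hm : Valued.v (lam - jE ((u : Matrix (Fin 1) (Fin 1) E) 0 0)) = WithZero.exp (-(m : ℤ)))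
    (hjl : Valued.v ((lam - jE ((u : Matrix (Fin 1) (Fin 1) E) 0 0)) - ρ (lam - jE ((u : Matrix (Fin 1) (Fin 1) E) 0 0))) = WithZero.exp (-(jl : ℤ)))
    -- the HYPERBOLIC literal `((Φ₂).over E, 1; γ₂, φ, h, f)` with its isotropic vector (‹CORE.v1›'s `_hhyper`)
    (γ₂ : GL (Fin 2) E) (φ : (Fin 2 → E) →+ M) (h : M) (hφs : ∀ (c : E) (x : Fin 2 → E), φ (c • x) = jE c * φ x) (hφi : Function.Injective φ) (hφo : Function.Surjective φ)
    (hφγ : ∀ x, φ ((γ₂ : Matrix (Fin 2) (Fin 2) E).mulVec x) = lam * φ x)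
    (hform : ∀ x y, jE (pairing σ ((StdForm.antidiagonal 2).over E) x y) = h * Θ (φ x) * φ y + ρ (h * Θ (φ x) * φ y)) (hΘh : Θ h = h) (hh : h ≠ 0)
    (hhyper : ∃ x : M, x ≠ 0 ∧ h * Θ x * x + ρ (h * Θ x * x) = 0)
    (f : ℕ → ℕ → AddSubgroup M → ℕ) (hfinLS : ∀ j a, (levelSet ρ Θ α (jE ϖ) h j a).Finite)
    (hf : ∀ (b j : ℕ) (Λ : AddSubgroup M) (x₀ : M) (r : E), 1 ≤ b → x₀ ≠ 0 → (∀ x, x ∈ Λ ↔ ∃ z, IsOrd ρ α (jE ϖ ^ j) z ∧ x = x₀ * z) →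
      IsOrd ρ α (jE ϖ ^ j) (dualGen ρ Θ α (jE ϖ ^ j) h x₀) → ¬ IsOrd ρ α (jE ϖ ^ j) (dualGen ρ Θ α (jE ϖ ^ j) h x₀ / jE ϖ) → Valued.v (dualGen ρ Θ α (jE ϖ ^ j) h x₀) = Valued.v (jE ϖ) ^ b →
      (∀ b', (∀ x ∈ Λ, Valued.v (h * Θ x * b' + ρ (h * Θ x * b')) ≤ 1) → (lam - jE ((u : Matrix (Fin 1) (Fin 1) E) 0 0)) * b' ∈ Λ) → IsOrd ρ α (jE ϖ ^ j) lam →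
      jE r = glueUnit ρ Θ α (jE ϖ ^ j) h (jE ϖ) (jE (1 : E)) x₀ b →
      f b j Λ = Nat.card {x : 𝒪[E] ⧸ 𝓂[E] ^ (2 * b) // ∃ u' : 𝒪[E], Ideal.Quotient.mk (𝓂[E] ^ (2 * b)) u' = x ∧ Valued.v ((u' : E) * σ u' - r) ≤ Valued.v (ϖ ^ (2 * b))})
    -- the ANISOTROPIC literal `(diag dg, η; P₁, γA, φ′, h′, f′)` with its anisotropy (‹CORE.v1›'s premise)
    (P₁ : GL (Fin 3) E) (dg : Fin 2 → E) (η : E) (γA : GL (Fin 2) E)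
    (hA : formCongr σ P₁ ((StdForm.antidiagonal 3).over E) =
      (!![(Matrix.diagonal dg) 0 0, 0, (Matrix.diagonal dg) 0 1; 0, η, 0; (Matrix.diagonal dg) 1 0, 0, (Matrix.diagonal dg) 1 1] : Matrix (Fin 3) (Fin 3) E))
    (hdgσ : ∀ i, σ (dg i) = dg i) (hησ : σ η = η) (hη1 : Valued.v η = 1) (hηN : ¬ ∃ t : E, t * σ t = η)
    (φ' : (Fin 2 → E) →+ M) (h' : M) (hφ's : ∀ (c : E) (x : Fin 2 → E), φ' (c • x) = jE c * φ' x) (hφ'i : Function.Injective φ') (hφ'o : Function.Surjective φ')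
    (hφ'γ : ∀ x, φ' ((γA : Matrix (Fin 2) (Fin 2) E).mulVec x) = lam * φ' x)
    (hform' : ∀ x y, jE (pairing σ (Matrix.diagonal dg) x y) = h' * Θ (φ' x) * φ' y + ρ (h' * Θ (φ' x) * φ' y)) (hΘh' : Θ h' = h') (hh' : h' ≠ 0)
    (haniso : ¬ ∃ x : M, x ≠ 0 ∧ h' * Θ x * x + ρ (h' * Θ x * x) = 0)
    (f' : ℕ → ℕ → AddSubgroup M → ℕ) (hfinLS' : ∀ j a, (levelSet ρ Θ α (jE ϖ) h' j a).Finite)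
    (hf' : ∀ (b j : ℕ) (Λ : AddSubgroup M) (x₀ : M) (r : E), 1 ≤ b → x₀ ≠ 0 → (∀ x, x ∈ Λ ↔ ∃ z, IsOrd ρ α (jE ϖ ^ j) z ∧ x = x₀ * z) →
      IsOrd ρ α (jE ϖ ^ j) (dualGen ρ Θ α (jE ϖ ^ j) h' x₀) → ¬ IsOrd ρ α (jE ϖ ^ j) (dualGen ρ Θ α (jE ϖ ^ j) h' x₀ / jE ϖ) → Valued.v (dualGen ρ Θ α (jE ϖ ^ j) h' x₀) = Valued.v (jE ϖ) ^ b →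
      (∀ b', (∀ x ∈ Λ, Valued.v (h' * Θ x * b' + ρ (h' * Θ x * b')) ≤ 1) → (lam - jE ((u : Matrix (Fin 1) (Fin 1) E) 0 0)) * b' ∈ Λ) → IsOrd ρ α (jE ϖ ^ j) lam →
      jE r = glueUnit ρ Θ α (jE ϖ ^ j) h' (jE ϖ) (jE η) x₀ b →
      f' b j Λ = Nat.card {x : 𝒪[E] ⧸ 𝓂[E] ^ (2 * b) // ∃ u' : 𝒪[E], Ideal.Quotient.mk (𝓂[E] ^ (2 * b)) u' = x ∧ Valued.v ((u' : E) * σ u' - r) ≤ Valued.v (ϖ ^ (2 * b))})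
    -- the live row and its window (`N = 0` allowed)
    (b : ℕ) (hb1 : 1 ≤ b) (hb2 : 2 * b + 1 = m) {N : ℕ} (hNjl : m + 2 * N = jl)
    -- the TOP chart
    {κ₀ ξ₀ : M} (hκ₀ : κ₀ + ρ κ₀ = 1) (hΘκ₀ : Θ κ₀ = κ₀) (hκ₀v : Valued.v κ₀ = 1) (hξ : ρ ξ₀ = -ξ₀) (hΘξ : Θ ξ₀ = ξ₀)
    (hξN : Valued.v ξ₀ = exp (2 * (N : ℤ)))
    -- the top digit system, `2d − 1 ≤ n ≤ b`
    (Rd : Finset E) {n : ℕ} (hn : 2 * d - 1 ≤ n) (hnb : n ≤ b) (hRd1 : ∀ V ∈ Rd, σ V = V ∧ Valued.v V ≤ 1)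
    (hRd2 : ∀ V : E, σ V = V → Valued.v V ≤ 1 → ∃ V₀ ∈ Rd, Valued.v (V - V₀) ≤ Valued.v ϖ ^ n)
    (hRd3 : ∀ V ∈ Rd, ∀ V' ∈ Rd, Valued.v (V - V') ≤ Valued.v ϖ ^ n → V = V') :
    ∃ φd : ℤ,
      ((∑ᶠ Λ ∈ levelSetDep ρ Θ α (jE ϖ) h (b + 2 * N) b (lam - jE ((u : Matrix (Fin 1) (Fin 1) E) 0 0)), f b (b + 2 * N) Λ : ℕ) : ℤ) =
        φd * ((Rd.filter (fun V₀ : E => Valued.v (κ₀ + jE V₀ * ξ₀) * Valued.v (jE ϖ ^ (b + 2 * N) * (α - ρ α)) = Valued.v (jE ϖ) ^ b ∧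
          ∃ e : M, ρ e = e ∧ e * Θ e = (κ₀ + jE V₀ * ξ₀) * ρ (κ₀ + jE V₀ * ξ₀) / (h * ρ h))).card : ℤ) ∧
      (N < d → ((∑ᶠ Λ ∈ levelSetDep ρ Θ α (jE ϖ) h' (b + 2 * N) b (lam - jE ((u : Matrix (Fin 1) (Fin 1) E) 0 0)), f' b (b + 2 * N) Λ : ℕ) : ℤ) =
        φd * ((Rd.filter (fun V₀ : E => Valued.v (κ₀ + jE V₀ * ξ₀) * Valued.v (jE ϖ ^ (b + 2 * N) * (α - ρ α)) = Valued.v (jE ϖ) ^ b ∧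
          ∃ e : M, ρ e = e ∧ e * Θ e = (κ₀ + jE V₀ * ξ₀) * ρ (κ₀ + jE V₀ * ξ₀) / (h' * ρ h'))).card : ℤ)) := by
  obtain ⟨h2v, -⟩ := two_le_d hD h2
  have hρj : ∀ a, ρ (jE a) = jE a := fun a => (hjfix (jE a)).2 ⟨a, rfl⟩
  -- the two literals' hermitian letters (as in ★ `row_of_core` ∕ ★ A3)
  have hH₂σ : ((((StdForm.antidiagonal 2).over E).map σ))ᵀ = (StdForm.antidiagonal 2).over E := by rw [StdForm.over_map, StdForm.transpose_over]
  have hH₂σ' : ((Matrix.diagonal dg).map σ)ᵀ = Matrix.diagonal dg := by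
    rw [Matrix.diagonal_map (map_zero _), Matrix.diagonal_transpose]; exact congrArg Matrix.diagonal (funext hdgσ)
  have h1v : Valued.v (1 : E) = 1 := Valuation.map_one _
  have h1σ : σ 1 = 1 := map_one σ
  have hqq : (Nat.card 𝓀[E] : ℤ) ^ b * (Nat.card 𝓀[E] : ℤ) ^ b = (Nat.card 𝓀[E] : ℤ) ^ (2 * b) := by rw [← pow_add, ← two_mul]
  have hjli : 2 * b + 2 * N ≤ jl := by omega
  -- the diagonal sizes `n_t(b, b) = q^b·q^b`
  have hnD := rowSize_diag_odd hD hσσ h2 hρρ hvρ hρj hjv hjfix hΘj hΘΘ hΘρ hvΘ hα hα1 hint hvlam hU hτ hσres hDM hjiso hq hjpow hϖmax hm hjl hH₂σ h1v h1σ hφs hφi hφo hφγ hform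
    hΘh hh hfinLS hf b hb2 hb1
  have hnD' := rowSize_diag_odd hD hσσ h2 hρρ hvρ hρj hjv hjfix hΘj hΘΘ hΘρ hvΘ hα hα1 hint hvlam hU hτ hσres hDM hjiso hq hjpow hϖmax hm hjl hH₂σ' hη1 hησ hφ's hφ'i hφ'o hφ'γ
    hform' hΘh' hh' hfinLS' hf' b hb2 hb1
  refine topCell_density_exists hD h2v jE hjfix hΘj hjiso hρρ hvρ hΘρ P₁ dg η hA hηN φ hform hΘh hh φ' hform' hΘh' hh' hκ₀ hΘκ₀ hκ₀v hξ hΘξ hξN hU rfl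
    Rd hRd1 hRd2 hRd3 hn (by omega) _ _ ?_ ?_ ?_ ?_
  · intro hN0; subst hN0
    simp only [Nat.mul_zero, Nat.add_zero]
    exact ⟨hnD.trans hqq, hnD'.trans hqq⟩
  · intro hN1 hlt
    exact ⟨by rw [rowSize_near_odd hD hσσ h2 hρρ hvρ hρj hjv hjfix hΘj hΘΘ hΘρ hvΘ hα hα1 hint hvlam hU hτ hσres hDM hjiso hq hjpow hϖmax hm hjl hH₂σ h1v h1σ hφs hφi hφo hφγ
        hform hΘh hh hfinLS hf b hb2 hb1 N hN1 hlt hjli, hnD, hqq],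
      by rw [rowSize_near_odd hD hσσ h2 hρρ hvρ hρj hjv hjfix hΘj hΘΘ hΘρ hvΘ hα hα1 hint hvlam hU hτ hσres hDM hjiso hq hjpow hϖmax hm hjl hH₂σ' hη1 hησ hφ's hφ'i hφ'o
        hφ'γ hform' hΘh' hh' hfinLS' hf' b hb2 hb1 N hN1 hlt hjli, hnD', hqq]⟩
  · intro hN1 heq
    exact ⟨by rw [rowSize_boundary_hyp_odd hD hσσ h2 hρρ hvρ hρj hjv hjfix hΘj hΘΘ hΘρ hvΘ hα hα1 hint hvlam hU hτ hσres hDM hjiso hq hjpow hϖmax hm hjl hH₂σ h1v h1σ hφs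
        hφi hφo hφγ hform hΘh hh hfinLS hf b hb2 hb1 hhyper N heq hjli, hnD, hqq],
      by rw [rowSize_boundary_aniso_odd hD hσσ h2 hρρ hvρ hρj hjv hjfix hΘj hΘΘ hΘρ hvΘ hα hα1 hint hvlam hU hτ hσres hDM hjiso hq hjpow hϖmax hm hjl hH₂σ' hη1 hησ
        hφ's hφ'i hφ'o hφ'γ hform' hΘh' hh' hfinLS' hf' b hb2 hb1 haniso N heq hjli, hnD', hqq]⟩
  · intro hN1 hdi
    rw [rowSize_far_hyp_odd hD hσσ h2 hρρ hvρ hρj hjv hjfix hΘj hΘΘ hΘρ hvΘ hα hα1 hint hvlam hU hτ hσres hDM hjiso hq hjpow hϖmax hm hjl hH₂σ h1v h1σ hφs hφi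
        hφo hφγ hform hΘh hh hfinLS hf b hb2 hb1 hhyper N hdi hjli, hnD, hqq]

end Summit.HodgeConjecture.HodgeConjecture.Cruxes.H413.F0P3cDyRamTopCellDensityOfRow

end
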